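import Literature.Analysis.FluidPDE.AncientLimitVanishing
import Literature.Analysis.FluidPDE.ESSFarFieldVorticityHalfSpace
import Literature.Analysis.FluidPDE.TsaiSelfSimilarBounded
import HarnessLib

/-!
# HALF-SPACE copies of the two steps of the ESS endgame (tools for stub Z2 `stub_halfSpaceLiouville` of the line
# `radius_dichotomy`, item `TerminalTrace.TypeITraceScarL3`, stmt-NavierStokesRegularity-18385)

Seat nsreg-C26-p1 g5 (cell ns-regularity-ideate), `--supports stmt-NavierStokesRegularity-18385`.

The tree's `Literature.Analysis.FluidPDE.AncientLimitVanishing` runs the endgame of Escauriaza–Seregin–Šverák with the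
far field `{|x| > R}`; the one-direction backward-uniqueness input already exists on a HALF-SPACE
(`farField_curl_eq_zero_halfSpace`). This file records the two half-space copies the line needs:

* `halfSpace_farField_representative` — if a local energy ancient solution with uniform local pressure bounds and
  weak vanishing at the top time is a.e. bounded on `]-2, 0[ × {⟨x, e⟩ > R₀}`, then on `]-1, 0[ × {⟨x, e⟩ > R₀ + 1}`
  it has a jointly continuous representative with smooth slices whose vorticity vanishes on
  `]-1, 0[ × {⟨x, e⟩ > R₀ + 2}` (verbatim `farField_representative_of_local_pressure`, the exterior of a ball
  replaced by a half-space, `farField_curl_eq_zero` by `farField_curl_eq_zero_halfSpace`);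
* `strip_ae_bound_of_halfSpace_farField` — on a strip `]a, b[ × ℝ³`, `b ≤ 0`, carrying a global a.e. velocity bound,
  the smooth strip representative has vorticity of class `C¹₂` with `|∂ₜω − Δω| ≤ 2K(|ω| + |∇ω|)` vanishing on the far
  half-space, hence everywhere on the strip by unique continuation across the hyperplanes `⟨x, e⟩ = const`
  (`Carleman.uniqueContinuation_uncurried_c12`, apex moved to `x + μ e` deep in the half-space); so every slice is
  an entire BOUNDED harmonic field, i.e. a constant (`isConst_of_harmonic_bounded_inner`), and the constant is
  bounded by the a.e. bound `K'` the solution obeys on the far half-space: `‖w(s, ·)‖ ≤ K'` a.e., for a.e. `s`.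
WHAT THIS IS NOT: 18385 / NS regularity NOT proved. [cite: EscauriazaSereginSverak2003, §3 (3.26)–(3.32), Thms. 4.1, 5.1]
-/

noncomputable section

set_option linter.dupNamespace false

namespace Summit.NavierStokesRegularity.NavierStokesRegularity.Theorems.TypeITraceScarL3

open MeasureTheory TopologicalSpace Set Function Filter Metric
open _root_.Topology
open Literature.Analysis.FluidPDE
open scoped ENNReal NNReal InnerProductSpace RealInnerProductSpace Laplacian

variable {w : ℝ → EuclideanSpace ℝ (Fin 3) → EuclideanSpace ℝ (Fin 3)}
  {π : ℝ → EuclideanSpace ℝ (Fin 3) → ℝ}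

/-- Points of the half-space `{⟨x, e⟩ > R + 1}` have their unit ball inside `{⟨x, e⟩ > R}` (`‖e‖ = 1`). [folklore] -/
theorem ball_subset_halfSpace_of_mem {e : EuclideanSpace ℝ (Fin 3)} (he : ‖e‖ = 1) {R : ℝ}
    {x : EuclideanSpace ℝ (Fin 3)} (hx : R + 1 < ⟪x, e⟫) {ρ : ℝ} (hρ : ρ ≤ 1) :
    ball x ρ ⊆ {y : EuclideanSpace ℝ (Fin 3) | R < ⟪y, e⟫} := by
  intro y hy
  rw [mem_ball, dist_eq_norm] at hy
  show R < ⟪y, e⟫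
  have h1 : |⟪y - x, e⟫| ≤ ‖y - x‖ := by
    simpa [he] using abs_real_inner_le_norm (y - x) e
  have h2 : ⟪y, e⟫ = ⟪x, e⟫ + ⟪y - x, e⟫ := by
    rw [← inner_add_left, add_sub_cancel]
  have h3 := neg_abs_le ⟪y - x, e⟫
  rw [h2]
  linarith

/-- **The far-field representative on a half-space and the vanishing of its vorticity** (ESS 2003, §3
(3.26)–(3.32) with the half-space backward uniqueness Thm. 5.1): if `|w| ≤ L` a.e. on `]-2, 0[ × {⟨x, e⟩ > R₀}`,
`‖e‖ = 1`, then on `]-1, 0[ × {⟨x, e⟩ > R₀ + 1}` the field `w` has a jointly continuous representative `Uf` with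
smooth slices, and `curl Uf = 0` on `]-1, 0[ × {⟨x, e⟩ > R₀ + 2}`. [cite: EscauriazaSereginSverak2003, §3 (3.26)–(3.32), Thm. 5.1] -/
theorem halfSpace_farField_representative
    (hw : ∀ a : ℝ, 0 < a →
      IsSuitableWeakSolutionInBall a (0 : ℝ × EuclideanSpace ℝ (Fin 3)) w π)
    {P : ℝ≥0} (hP : ∀ z₀ : ℝ × EuclideanSpace ℝ (Fin 3), z₀.1 ≤ 0 →
      ∫⁻ q in parabolicCylinder 1 z₀, ‖π q.1 q.2‖ₑ ^ (3 / 2 : ℝ) ≤ P)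
    (htop : ∀ φ : EuclideanSpace ℝ (Fin 3) → EuclideanSpace ℝ (Fin 3), ContDiff ℝ (⊤ : ℕ∞) φ →
      HasCompactSupport φ → ∀ ε : ℝ, 0 < ε →
        ∃ s₀ : ℝ, s₀ < 0 ∧ ∀ᵐ s ∂(volume.restrict (Ioo s₀ 0)), |∫ y, ⟪w s y, φ y⟫| ≤ ε)
    {e : EuclideanSpace ℝ (Fin 3)} (he : ‖e‖ = 1) {R₀ L : ℝ}
    (hfar : ∀ᵐ z ∂(volume.restrict
      (Ioo (-2 : ℝ) 0 ×ˢ {x : EuclideanSpace ℝ (Fin 3) | R₀ < ⟪x, e⟫})), ‖w z.1 z.2‖ ≤ L) :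
    ∃ Uf : ℝ → EuclideanSpace ℝ (Fin 3) → EuclideanSpace ℝ (Fin 3),
      uncurry Uf =ᵐ[volume.restrict
        (Ioo (-1 : ℝ) 0 ×ˢ {x : EuclideanSpace ℝ (Fin 3) | R₀ + 1 < ⟪x, e⟫})] uncurry w ∧
      ContinuousOn (uncurry Uf)
        (Ioo (-1 : ℝ) 0 ×ˢ {x : EuclideanSpace ℝ (Fin 3) | R₀ + 1 < ⟪x, e⟫}) ∧
      ∀ z ∈ Ioo (-1 : ℝ) 0 ×ˢ {x : EuclideanSpace ℝ (Fin 3) | R₀ + 1 + 1 < ⟪x, e⟫},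
        curl (Uf z.1) z.2 = 0 := by
  have hSo : IsOpen {x : EuclideanSpace ℝ (Fin 3) | R₀ + 1 < ⟪x, e⟫} :=
    isOpen_lt continuous_const (continuous_id.inner continuous_const)
  -- the thickening condition and the bound in the required shape
  have hSS' : ∀ x ∈ {x : EuclideanSpace ℝ (Fin 3) | R₀ + 1 < ⟪x, e⟫},
      ball x (2 * (1 / 2 : ℝ)) ⊆ {y : EuclideanSpace ℝ (Fin 3) | R₀ < ⟪y, e⟫} :=
    fun x hx => ball_subset_halfSpace_of_mem he hx (by norm_num)
  have hbd : ∀ᵐ z ∂(volume.restrict (Ioo ((-1 : ℝ) - 4 * (1 / 2 : ℝ) ^ 2) 0 ×ˢ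
      {y : EuclideanSpace ℝ (Fin 3) | R₀ < ⟪y, e⟫})), ‖w z.1 z.2‖ ≤ L := by
    rw [show (-1 : ℝ) - 4 * (1 / 2 : ℝ) ^ 2 = -2 by norm_num]
    exact hfar
  obtain ⟨K, U, hUw, hUc, hCD, hjc, hbdK⟩ := exists_representative_of_ae_bound_of_local_pressure
    hw hP hSo (by norm_num : (0 : ℝ) < 1 / 2) (by norm_num) le_rfl hSS' hbd
  refine ⟨U, hUw, hUc, ?_⟩
  -- notation
  set S : Set (EuclideanSpace ℝ (Fin 3)) := {x : EuclideanSpace ℝ (Fin 3) | R₀ + 1 < ⟪x, e⟫} with hS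
  set Ω : Set (ℝ × EuclideanSpace ℝ (Fin 3)) := Ioo (-1 : ℝ) 0 ×ˢ S with hΩ
  have hΩo : IsOpen Ω := isOpen_Ioo.prod hSo
  -- the equations hold for the representative
  have hsolw : IsDistributionalNSSolutionOn ⟨Ω, hΩo⟩ 1 0 w π :=
    isDistributionalNSSolutionOn_of_forall_cylinder (fun a' ha' => (hw a' ha').1.distributional)
      hΩo (prod_mono Ioo_subset_Iio_self (subset_univ _))
  have hsol : IsDistributionalNSSolutionOn ⟨Ω, hΩo⟩ 1 0 U π :=
    hsolw.congr_ae hUw.symm (ae_of_all _ fun _ => rfl)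
  have hU4 : ∀ t ∈ Ioo (-1 : ℝ) 0, ContDiffOn ℝ 4 (U t) S := fun t ht x hx =>
    ((hCD (t, x) ⟨ht, hx⟩).of_le (by norm_cast)).contDiffWithinAt
  have hΦ : ∀ n ≤ 4, ContinuousOn
      (fun z : ℝ × EuclideanSpace ℝ (Fin 3) => iteratedFDeriv ℝ n (U z.1) z.2) Ω := fun n _ => hjc n
  have hK : ∀ n ≤ 3, ∀ z ∈ Ω, ‖iteratedFDeriv ℝ n (U z.1) z.2‖ ≤ K :=
    fun n hn z hz => hbdK n (by omega) z hz
  exact farField_curl_eq_zero_halfSpace he htop hUw hsol hU4 hΦ hK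

set_option maxHeartbeats 1600000 in
/-- **The interior step on a strip, half-space far field, bounded slices** (ESS 2003, §3 after (3.32), Thm. 4.1;
Seregin 2014, Ch. 7 p. 139). Let `(w, π)` be suitable in every `Q(a)` with uniform local pressure bounds, `Uf` its
far-field representative on `]-1, 0[ × {⟨x, e⟩ > R₁}` with `curl Uf = 0` for `⟨x, e⟩ > R₁ + 1`, `]a, b[ × ℝ³ ⊆ ]-1, 0] × ℝ³`
a strip with `|w| ≤ L` a.e. on `]a − 4ρ², b[ × ℝ³` (`0 < ρ ≤ 1/2`) and `|w| ≤ K'` a.e. on `]a, b[ × {⟨x, e⟩ > R₁}`. Then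
`‖w(s, ·)‖ ≤ K'` a.e., for a.e. `s ∈ ]a, b[`: the vorticity of the smooth strip representative vanishes on the far
half-space, hence at every point of the strip by unique continuation through the hyperplanes
(`Carleman.uniqueContinuation_uncurried_c12`, apex `x + μe`); each slice is then an entire harmonic field bounded by
the strip constant, i.e. constant (`isConst_of_harmonic_bounded_inner`), and the constant is read off in the far
half-space where the representative is bounded by `K'`. [cite: EscauriazaSereginSverak2003, §3 after (3.32) and Thm. 4.1] [cite: Seregin2014, Ch. 7 p. 139] -/
theorem strip_ae_bound_of_halfSpace_farField
    (hw : ∀ a : ℝ, 0 < a →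
      IsSuitableWeakSolutionInBall a (0 : ℝ × EuclideanSpace ℝ (Fin 3)) w π)
    {P : ℝ≥0} (hP : ∀ z₀ : ℝ × EuclideanSpace ℝ (Fin 3), z₀.1 ≤ 0 →
      ∫⁻ q in parabolicCylinder 1 z₀, ‖π q.1 q.2‖ₑ ^ (3 / 2 : ℝ) ≤ P)
    {e : EuclideanSpace ℝ (Fin 3)} (he : ‖e‖ = 1)
    {R₁ : ℝ} {Uf : ℝ → EuclideanSpace ℝ (Fin 3) → EuclideanSpace ℝ (Fin 3)}
    (hUf : uncurry Uf =ᵐ[volume.restrict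
      (Ioo (-1 : ℝ) 0 ×ˢ {x : EuclideanSpace ℝ (Fin 3) | R₁ < ⟪x, e⟫})] uncurry w)
    (hUfc : ContinuousOn (uncurry Uf)
      (Ioo (-1 : ℝ) 0 ×ˢ {x : EuclideanSpace ℝ (Fin 3) | R₁ < ⟪x, e⟫}))
    (hcurl : ∀ z ∈ Ioo (-1 : ℝ) 0 ×ˢ {x : EuclideanSpace ℝ (Fin 3) | R₁ + 1 < ⟪x, e⟫},
      curl (Uf z.1) z.2 = 0)
    {a b ρ L K' : ℝ} (hρ : 0 < ρ) (hρ1 : 2 * ρ ≤ 1) (ha : -1 ≤ a - 4 * ρ ^ 2) (hb : b ≤ 0)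
    (hbd : ∀ᵐ z ∂(volume.restrict
      (Ioo (a - 4 * ρ ^ 2) b ×ˢ (univ : Set (EuclideanSpace ℝ (Fin 3))))), ‖w z.1 z.2‖ ≤ L)
    (hK' : ∀ᵐ z ∂(volume.restrict
      (Ioo a b ×ˢ {x : EuclideanSpace ℝ (Fin 3) | R₁ < ⟪x, e⟫})), ‖w z.1 z.2‖ ≤ K') :
    ∀ᵐ s ∂(volume.restrict (Ioo a b)), ∀ᵐ y : EuclideanSpace ℝ (Fin 3), ‖w s y‖ ≤ K' := by
  -- ### the representative on the strip (verbatim `strip_velocity_ae_zero_of_liouville`)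
  set I : Set ℝ := Ioo a b with hIdef
  have hIo : IsOpen I := isOpen_Ioo
  set Ω : Set (ℝ × EuclideanSpace ℝ (Fin 3)) := I ×ˢ (univ : Set (EuclideanSpace ℝ (Fin 3))) with hΩdef
  have hΩo : IsOpen Ω := hIo.prod isOpen_univ
  have hIsub : I ⊆ Ioo (-1 : ℝ) 0 := Ioo_subset_Ioo (by nlinarith [sq_nonneg ρ]) hb
  have hHo : IsOpen {x : EuclideanSpace ℝ (Fin 3) | R₁ < ⟪x, e⟫} :=
    isOpen_lt continuous_const (continuous_id.inner continuous_const)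
  obtain ⟨K, U, hUw, hUc, hCD, hjc, hbdK⟩ := exists_representative_of_ae_bound_of_local_pressure
    hw hP (S := univ) (S' := univ) isOpen_univ hρ hρ1 hb (fun x _ => subset_univ _) hbd
  -- the equations hold for the representative
  have hsolw : IsDistributionalNSSolutionOn ⟨Ω, hΩo⟩ 1 0 w π :=
    isDistributionalNSSolutionOn_of_forall_cylinder (fun a' ha' => (hw a' ha').1.distributional)
      hΩo (prod_mono (hIsub.trans Ioo_subset_Iio_self) Subset.rfl)
  have hsol : IsDistributionalNSSolutionOn ⟨Ω, hΩo⟩ 1 0 U π :=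
    hsolw.congr_ae hUw.symm (ae_of_all _ fun _ => rfl)
  have hU4 : ∀ t ∈ I, ContDiffOn ℝ 4 (U t) (univ : Set (EuclideanSpace ℝ (Fin 3))) :=
    fun t ht x _ =>
      ((hCD (t, x) ⟨ht, mem_univ _⟩).of_le (by norm_cast)).contDiffWithinAt
  have hΦ : ∀ n ≤ 4, ContinuousOn
      (fun z : ℝ × EuclideanSpace ℝ (Fin 3) => iteratedFDeriv ℝ n (U z.1) z.2) Ω := fun n _ => hjc n
  have hK₀ : ∀ z ∈ Ω, ‖U z.1 z.2‖ ≤ K := fun z hz => by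
    have h := hbdK 0 (by norm_num) z hz
    rwa [norm_iteratedFDeriv_zero] at h
  have hK₁ : ∀ z ∈ Ω, ‖fderiv ℝ (U z.1) z.2‖ ≤ K := fun z hz => by
    have h := hbdK 1 (by norm_num) z hz
    rwa [norm_iteratedFDeriv_one] at h
  -- ### the vorticity: class `C¹₂`, equation, far-field vanishing on the half-space
  obtain ⟨hdiv, -, -, hω1, hωx⟩ :=
    vorticity_c12_of_isDistributionalNSSolutionOn hIo isOpen_univ hsol hU4 hΦ
  obtain ⟨-, -, hineq⟩ := vorticity_carleman_inequality hIo isOpen_univ hsol hU4 hΦ hK₀ hK₁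
  have hωbd : ∀ z ∈ Ω, ‖(uncurry (vorticity U)) z‖ ≤ ‖curlCLM‖ * K := fun z hz => by
    show ‖vorticity U z.1 z.2‖ ≤ _
    rw [vorticity_apply]
    exact (norm_curl_le _ _).trans
      (mul_le_mul_of_nonneg_left (hK₁ z hz) (ContinuousLinearMap.opNorm_nonneg curlCLM))
  -- the representative agrees with the far-field representative on the far half-space
  set O : Set (ℝ × EuclideanSpace ℝ (Fin 3)) := I ×ˢ {x : EuclideanSpace ℝ (Fin 3) | R₁ < ⟪x, e⟫} with hO
  have hOo : IsOpen O := hIo.prod hHo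
  have hOΩ : O ⊆ Ω := prod_mono Subset.rfl (subset_univ _)
  have hOF : O ⊆ Ioo (-1 : ℝ) 0 ×ˢ {x : EuclideanSpace ℝ (Fin 3) | R₁ < ⟪x, e⟫} :=
    prod_mono hIsub Subset.rfl
  have haeO : uncurry U =ᵐ[volume.restrict O] uncurry w :=
    ae_restrict_of_ae_restrict_of_subset hOΩ hUw
  have hfarΩ : ∀ z ∈ I ×ˢ {x : EuclideanSpace ℝ (Fin 3) | R₁ + 1 < ⟪x, e⟫}, vorticity U z.1 z.2 = 0 := by
    have hae2 : uncurry Uf =ᵐ[volume.restrict O] uncurry w :=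
      ae_restrict_of_ae_restrict_of_subset hOF hUf
    have hae : uncurry U =ᵐ[volume.restrict O] uncurry Uf := haeO.trans hae2.symm
    have heqOn : EqOn (uncurry U) (uncurry Uf) O :=
      Measure.eqOn_open_of_ae_eq hae hOo (hUc.mono hOΩ) (hUfc.mono hOF)
    rintro ⟨t, x⟩ ⟨ht, hx⟩
    have hx' : R₁ + 1 < ⟪x, e⟫ := hx
    have hxc : x ∈ {x : EuclideanSpace ℝ (Fin 3) | R₁ < ⟪x, e⟫} := by
      show R₁ < ⟪x, e⟫
      linarith
    have hev : U t =ᶠ[𝓝 x] Uf t := slice_eventuallyEq hOo heqOn (w := (t, x)) ⟨ht, hxc⟩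
    show vorticity U t x = 0
    rw [vorticity_apply, curl_eq_curlCLM, hev.fderiv_eq, ← curl_eq_curlCLM]
    exact hcurl (t, x) ⟨hIsub ht, hx'⟩
  -- ### unique continuation through the hyperplanes `⟨x, e⟩ = const`, at every time of the strip
  have hωzero : ∀ t ∈ I, ∀ x : EuclideanSpace ℝ (Fin 3), vorticity U t x = 0 := by
    intro t ht x
    by_cases hxfar : R₁ + 1 < ⟪x, e⟫
    · exact hfarΩ (t, x) ⟨ht, hxfar⟩
    push Not at hxfar
    -- constants
    have hK0 : 0 ≤ K := (norm_nonneg _).trans (hK₀ (t, 0) ⟨ht, mem_univ _⟩)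
    set μ : ℝ := R₁ + 3 - ⟪x, e⟫ with hμdef
    have hμpos : 0 < μ := by rw [hμdef]; linarith
    set x₁ : EuclideanSpace ℝ (Fin 3) := x + μ • e with hx₁
    have hx₁e : ⟪x₁, e⟫ = R₁ + 3 := by
      rw [hx₁, inner_add_left, real_inner_smul_left, real_inner_self_eq_norm_sq, he]
      ring
    set Rb : ℝ := μ + 1 with hRb
    have hRbpos : 0 < Rb := by positivity
    set T' : ℝ := t - a with hT'
    have hT'pos : 0 < T' := by have := ht.1; simp only [hT']; linarith
    -- the affine map `A(s, y) = (t - s, x₁ + y)`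
    set A : ℝ × EuclideanSpace ℝ (Fin 3) → ℝ × EuclideanSpace ℝ (Fin 3) := stAffine (-1) 1 t x₁ with hAdef
    have hA1 : ∀ z : ℝ × EuclideanSpace ℝ (Fin 3), (A z).1 = t - z.1 := fun z => by
      show t + (-1) * z.1 = t - z.1; ring
    have hA2 : ∀ z : ℝ × EuclideanSpace ℝ (Fin 3), (A z).2 = x₁ + z.2 := fun z => by
      show x₁ + (1 : ℝ) • z.2 = x₁ + z.2; rw [one_smul]
    set Q' : Set (ℝ × EuclideanSpace ℝ (Fin 3)) :=
      Ioo (0 : ℝ) T' ×ˢ ball (0 : EuclideanSpace ℝ (Fin 3)) Rb with hQ'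
    have hAΩ' : ∀ z ∈ Ico (0 : ℝ) T' ×ˢ ball (0 : EuclideanSpace ℝ (Fin 3)) Rb, A z ∈ Ω := by
      rintro ⟨s, y⟩ ⟨hs, -⟩
      refine ⟨?_, mem_univ _⟩
      rw [hA1]
      have h1 := hs.1
      have h2 := hs.2
      simp only [hT'] at h2
      exact ⟨by simp only; linarith, by simp only; linarith [ht.2]⟩
    have hAΩ : ∀ z ∈ Q', A z ∈ Ω := fun z hz => hAΩ' z ⟨Ioo_subset_Ico_self hz.1, hz.2⟩
    -- the transported vorticity
    set ω : ℝ × EuclideanSpace ℝ (Fin 3) → EuclideanSpace ℝ (Fin 3) := uncurry (vorticity U) with hωdef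
    set u : ℝ × EuclideanSpace ℝ (Fin 3) → EuclideanSpace ℝ (Fin 3) := fun z => ω (A z) with hudef
    have hu1 : ContDiffOn ℝ 1 u Q' :=
      (Carleman.contDiffOn_comp_stAffine hω1 (-1) 1 t x₁).mono fun z hz => hAΩ z hz
    have hdxu : ∀ e' : EuclideanSpace ℝ (Fin 3),
        Carleman.dx e' u = fun z => Carleman.dx e' ω (A z) := by
      intro e'
      funext z
      rw [hudef, Carleman.dx_comp_stAffine (by norm_num) one_ne_zero ω e' z, one_smul]
    have hux : ∀ e' : EuclideanSpace ℝ (Fin 3), ContDiffOn ℝ 1 (Carleman.dx e' u) Q' := by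
      intro e'
      rw [hdxu e']
      exact (Carleman.contDiffOn_comp_stAffine (hωx e') (-1) 1 t x₁).mono fun z hz => hAΩ z hz
    have hucont : ContinuousOn u (Ico (0 : ℝ) T' ×ˢ ball (0 : EuclideanSpace ℝ (Fin 3)) Rb) :=
      (Carleman.continuousOn_comp_stAffine hω1.continuousOn (-1) 1 t x₁).mono fun z hz => hAΩ' z hz
    have hdtu : ∀ z, Carleman.dt u z = (-1 : ℝ) • Carleman.dt ω (A z) := fun z => by
      rw [hudef, Carleman.dt_comp_stAffine (by norm_num) one_ne_zero]
    have hlapu : ∀ z, Carleman.lap u z = Carleman.lap ω (A z) := fun z => by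
      rw [hudef, Carleman.lap_comp_stAffine (by norm_num) one_ne_zero, one_pow, one_smul]
    have hgradu : ∀ z, Carleman.gradSq u z = Carleman.gradSq ω (A z) := fun z => by
      rw [hudef, Carleman.gradSq_comp_stAffine (by norm_num) one_ne_zero, one_pow, one_mul]
    have hinequ : ∀ z ∈ Q', ‖Carleman.dt u z + Carleman.lap u z‖ ≤
        (K + K) * (‖u z‖ + Real.sqrt (Carleman.gradSq u z)) := by
      intro z hz
      rw [hdtu z, hlapu z, hgradu z]
      have e1 : (-1 : ℝ) • Carleman.dt ω (A z) + Carleman.lap ω (A z) =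
          -(Carleman.dt ω (A z) - Carleman.lap ω (A z)) := by
        rw [neg_one_smul]; abel
      rw [e1, norm_neg]
      exact hineq (A z) (hAΩ z hz)
    have hvan : ∀ k : ℕ, ∃ C : ℝ, ∀ z ∈ Q', ‖u z‖ ≤ C * (‖z.2‖ + Real.sqrt z.1) ^ k := by
      intro k
      refine ⟨‖curlCLM‖ * K, fun z hz => ?_⟩
      have hbase : 0 ≤ ‖z.2‖ + Real.sqrt z.1 := by positivity
      by_cases hy : ‖z.2‖ < 2
      · -- near the apex the transported vorticity vanishes identically (the ball `B(x₁, 2)` is far out)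
        have hfar' : R₁ + 1 < ⟪x₁ + z.2, e⟫ := by
          have h1 : |⟪z.2, e⟫| ≤ ‖z.2‖ := by simpa [he] using abs_real_inner_le_norm z.2 e
          have h2 := neg_abs_le ⟪z.2, e⟫
          rw [inner_add_left, hx₁e]
          linarith
        have h0 : u z = 0 := by
          have h := hfarΩ (A z) ⟨(hAΩ z hz).1, by rw [hA2]; exact hfar'⟩
          show ω (A z) = 0
          exact h
        rw [h0, norm_zero]
        positivity
      · push Not at hy
        have h1 : (1 : ℝ) ≤ (‖z.2‖ + Real.sqrt z.1) ^ k :=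
          one_le_pow₀ (by linarith [Real.sqrt_nonneg z.1])
        calc ‖u z‖ = ‖ω (A z)‖ := rfl
          _ ≤ ‖curlCLM‖ * K := hωbd _ (hAΩ z hz)
          _ = ‖curlCLM‖ * K * 1 := (mul_one _).symm
          _ ≤ ‖curlCLM‖ * K * (‖z.2‖ + Real.sqrt z.1) ^ k :=
              mul_le_mul_of_nonneg_left h1 (by positivity)
    have huc := Carleman.uniqueContinuation_uncurried_c12 3 3 (c₁ := K + K) (R := Rb) (T := T')
      (by positivity) hRbpos hT'pos hu1 hux hucont hinequ hvan
    -- evaluate at `y = x - x₁ = -μ e`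
    have hy : x - x₁ ∈ ball (0 : EuclideanSpace ℝ (Fin 3)) Rb := by
      rw [mem_ball_zero_iff, hx₁, show x - (x + μ • e) = -(μ • e) by abel, norm_neg, norm_smul,
        Real.norm_eq_abs, abs_of_pos hμpos, he, mul_one, hRb]
      linarith
    have h := huc (x - x₁) hy
    have hA0 : A (0, x - x₁) = (t, x) := by
      show (t + (-1) * (0 : ℝ), x₁ + (1 : ℝ) • (x - x₁)) = (t, x)
      simp
    have h' : ω (A (0, x - x₁)) = 0 := h
    rw [hA0] at h'
    exact h'
  -- ### the velocity slices are harmonic, bounded, hence constant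
  have hharm : ∀ t ∈ I, InnerProductSpace.HarmonicOnNhd (U t) (univ : Set (EuclideanSpace ℝ (Fin 3))) := by
    intro t ht x _
    have hcd : ContDiff ℝ 2 (U t) := contDiff_iff_contDiffAt.2 fun y =>
      (hCD (t, y) ⟨ht, mem_univ _⟩).of_le (by norm_cast)
    have hΔ : ∀ y, Δ (U t) y = 0 :=
      laplacian_eq_zero_of_curl_eq_zero_of_isDivFree hcd
        (fun y => by rw [← vorticity_apply]; exact hωzero t ht y)
        (fun y => hdiv (t, y) ⟨ht, mem_univ _⟩)
    show InnerProductSpace.HarmonicAt (U t) x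
    constructor
    · exact hcd.contDiffAt
    · exact Filter.Eventually.of_forall fun y => by rw [Pi.zero_apply]; exact hΔ y
  have hconst : ∀ t ∈ I, ∀ x y : EuclideanSpace ℝ (Fin 3), U t x = U t y := fun t ht =>
    isConst_of_harmonic_bounded_inner (hharm t ht) ⟨K, fun x => hK₀ (t, x) ⟨ht, mem_univ _⟩⟩
  -- ### the representative is bounded by `K'` on the far half-space (a.e., hence everywhere by continuity)
  have hUK' : ∀ z ∈ O, ‖U z.1 z.2‖ ≤ K' := by
    have hae1 : ∀ᵐ z ∂(volume.restrict O), ‖U z.1 z.2‖ ≤ K' := by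
      filter_upwards [haeO, hK'] with z hz hzK
      have : ‖uncurry U z‖ ≤ K' := by rw [hz]; exact hzK
      exact this
    have hopen : IsOpen (O ∩ (fun z : ℝ × EuclideanSpace ℝ (Fin 3) => ‖U z.1 z.2‖) ⁻¹' Ioi K') :=
      ((hUc.mono hOΩ).norm).isOpen_inter_preimage hOo isOpen_Ioi
    have hnull : volume (O ∩ (fun z : ℝ × EuclideanSpace ℝ (Fin 3) => ‖U z.1 z.2‖) ⁻¹' Ioi K') = 0 := by
      have h1 := (ae_restrict_iff' hOo.measurableSet).1 hae1
      rw [ae_iff] at h1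
      have e1 : {z : ℝ × EuclideanSpace ℝ (Fin 3) | ¬ (z ∈ O → ‖U z.1 z.2‖ ≤ K')} =
          O ∩ (fun z : ℝ × EuclideanSpace ℝ (Fin 3) => ‖U z.1 z.2‖) ⁻¹' Ioi K' := by
        ext z
        simp only [mem_setOf_eq, mem_inter_iff, mem_preimage, mem_Ioi, Classical.not_imp, not_le]
      rwa [e1] at h1
    have hempty := (hopen.measure_eq_zero_iff volume).1 hnull
    intro z hz
    by_contra h
    have hmem : z ∈ O ∩ (fun z : ℝ × EuclideanSpace ℝ (Fin 3) => ‖U z.1 z.2‖) ⁻¹' Ioi K' :=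
      ⟨hz, not_le.1 h⟩
    rw [hempty] at hmem
    exact hmem
  have hUbound : ∀ t ∈ I, ∀ y : EuclideanSpace ℝ (Fin 3), ‖U t y‖ ≤ K' := by
    intro t ht y
    have hx₂ : R₁ < ⟪(R₁ + 1) • e, e⟫ := by
      rw [real_inner_smul_left, real_inner_self_eq_norm_sq, he]
      linarith
    rw [hconst t ht y ((R₁ + 1) • e)]
    exact hUK' (t, (R₁ + 1) • e) ⟨ht, hx₂⟩
  -- ### a.e. slice: `U(t) = w(t)` a.e.
  have hslice : ∀ᵐ t ∂(volume.restrict I), U t =ᵐ[volume] w t := by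
    have h1 : ∀ᵐ z ∂((volume.restrict I).prod (volume : Measure (EuclideanSpace ℝ (Fin 3)))),
        uncurry U z = uncurry w z := by
      rw [Measure.restrict_prod_eq_prod_univ, ← Measure.volume_eq_prod]
      exact hUw
    filter_upwards [Measure.ae_ae_of_ae_prod h1] with t ht
    filter_upwards [ht] with x hx
    exact hx
  filter_upwards [ae_restrict_mem measurableSet_Ioo, hslice] with t ht hUt
  filter_upwards [hUt] with y hy
  have h : ‖U t y‖ ≤ K' := hUbound t ht y
  rw [hy] at h
  exact h

end Summit.NavierStokesRegularity.NavierStokesRegularity.Theorems.TypeITraceScarL3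

end
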